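import Summits.FinalStateConjecture.FinalStateConjecture.Theorems.BartnikGapSettlingBondiBartnikRigiditySlabCauchyRigidityDefs
import Summits.FinalStateConjecture.FinalStateConjecture.Theorems.SwallowTheDatumKerrShieldedSettlesStubCollarCauchy
import Literature.Geometry.Lorentzian.CausalityChronologyProofs
import Literature.Geometry.Lorentzian.CausalityClosedProofs
import HarnessLib

/-!
# F1' `stub_slabCauchyRigidity'`, step (c): the open Kerr slab is a Cauchy hypersurface of the slab
# lens of the Kerr star chart — line `direct-method-on-the-cone`, crux `BondiBartnikRigidity`
# (stmt-FinalStateConjecture-10807); module 1 of the landing of the conditional proof of F1'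

Route statement (C) `F1Route.KerrSlabLensCauchy` (`…SlabCauchyRigidityDefs.lean`), its Cauchy and
chronology parts: in the ingoing Kerr–Schild star chart `Kerr.region a M = {r > M}` (`0 < M`, `|a| < M`),
the open slab `slab° = {t* = 0, r < 3M}` is a Cauchy hypersurface of the lens
`V_K = {6M − 2r − 3t* > 0} ∩ {6M − 2r + 3t* > 0} ∩ {2t* + r − M > 0}` (`isCauchyHypersurface_slabKo`),
and `V_K ∩ {t* > 0} ⊆ I⁺_{V_K}(slab°)` (`diamondK_subset_chronologicalFuture`).  Connectedness of the
slab and of the lens is the companion module `…SlabCauchyRigidityLensConnected.lean`.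

ORDER THEORY OF THREE CLOCKS (template: `SwallowTheDatum….stub_collarCauchy`): along a future
timelike curve of the chart the Kerr–Schild speed limit `|ẋ⃗|_δ < ẋ⁰` (`η(v,v) ≤ g(v,v)`,
`CollarCauchy.minkowski_curve`) and `|∇r|²_δ = (r² + a²)/Σ ≤ 1 + a²/r² < 2` (`r > M > |a|`) give
`|ṙ| < √2 ẋ⁰`, so `t* + c r` is strictly increasing for `|c| ≤ 2/3` (`strictMonoOn_clock`); hence
`6M − 2r − 3t*` decreases and `6M − 2r + 3t*`, `2t* + r − M` increase to the future.  Existence of the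
crossing by the escape trichotomy and the Minkowski endpoint lemmas, the chart edge `r = M` being
unreachable pastward by the hole clock (`CollarCauchy.strictAntiOn_radius`), futureward by `2t* + r − M`.

References: O'Neill 1983, Ch. 14 [ONeill1983]; Visser, The Kerr spacetime: a brief introduction,
arXiv:0706.0622, (35) [arXiv07060622].  No definitions, no named facts.
-/

noncomputable section

-- D-0017: single-problem summit, `Summit.<S>.<S>.…` by design (cf. lakefile `weak.linter.dupNamespace`).
set_option linter.dupNamespace false

open Set Filter Function Topology TopologicalSpace
open Literature.Geometry.Lorentzian
open scoped Manifold ContDiff Topology RealInnerProductSpace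
open Summit.FinalStateConjecture.FinalStateConjecture.Theorems.SwallowTheDatum.KerrShieldedSettles.CollarCauchy
  (minkowski_curve hasDerivAt_radius_comp strictAntiOn_radius)

namespace Summit.FinalStateConjecture.FinalStateConjecture.Theorems.BondiBartnikRigidity.DirectMethod

namespace F1Route

/-! ### The speed limit and the clocks `t* + c r` -/

section Clocks

/-- **`|∇r|_δ ≤ √2` where `r ≥ |a|`**: `|∇r|² = (r² + a²)/Σ ≤ (r² + a²)/r² ≤ 2`
(`Kerr.inner_radiusGradVec_self`, `Kerr.sq_le_blSigma`). [cite: arXiv07060622, (35)] -/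
theorem norm_radiusGradVec_le {a : ℝ} {y : E3} (hr : 0 < Kerr.radius a (E4.ofTimeSpace 0 y))
    (har : |a| ≤ Kerr.radius a (E4.ofTimeSpace 0 y)) : ‖Kerr.radiusGradVec a y‖ ≤ Real.sqrt 2 := by
  have h2 : ‖Kerr.radiusGradVec a y‖ ^ 2 ≤ 2 := by
    rw [← real_inner_self_eq_norm_sq, Kerr.inner_radiusGradVec_self hr,
      div_le_iff₀ (Kerr.blSigma_pos hr)]
    have hS := Kerr.sq_le_blSigma hr
    have ha2 : a ^ 2 ≤ Kerr.radius a (E4.ofTimeSpace 0 y) ^ 2 := by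
      rw [← sq_abs a]; exact pow_le_pow_left₀ (abs_nonneg a) har 2
    nlinarith
  calc ‖Kerr.radiusGradVec a y‖ = Real.sqrt (‖Kerr.radiusGradVec a y‖ ^ 2) :=
        (Real.sqrt_sq (norm_nonneg _)).symm
    _ ≤ Real.sqrt 2 := Real.sqrt_le_sqrt h2

/-- **The speed limit for `r`**: `|dr(v⃗)| ≤ √2 ‖v⃗‖` at points with `r ≥ |a|`. [folklore] -/
theorem abs_radiusGrad_le {a : ℝ} {y : E3} (hr : 0 < Kerr.radius a (E4.ofTimeSpace 0 y))
    (har : |a| ≤ Kerr.radius a (E4.ofTimeSpace 0 y)) (v : E3) :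
    |Kerr.radiusGrad a y v| ≤ Real.sqrt 2 * ‖v‖ := by
  rw [Kerr.radiusGrad_apply]
  exact (abs_real_inner_le_norm _ _).trans
    (mul_le_mul_of_nonneg_right (norm_radiusGradVec_le hr har) (norm_nonneg _))

variable [Kerr.Facts] {M a : ℝ} {hM : 0 ≤ M} {γ : ℝ → Kerr.region a M} {s : Set ℝ}

/-- Along a future timelike curve of the chart `{r > M}`, `|a| < M`: `|ṙ| < (3/2) v⁰` (indeed
`< √2 v⁰`), from the Kerr–Schild cone comparison `‖v⃗‖ < v⁰` and `|∇r| ≤ √2`. [folklore] -/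
theorem abs_deriv_radius_lt (ha : |a| < M) (hγ : (Kerr.smoothMetric M a M).IsFutureTimelikeCurveOn
      ((Kerr.timeOrientation M a M hM).ofLE le_top) γ s) {t : ℝ} (ht : t ∈ s) :
    |Kerr.radiusGrad a (E4.spatial (γ t : E4)) (E4.spatial (deriv (fun σ => (γ σ : E4)) t))| <
      3 / 2 * deriv (fun σ => (γ σ : E4)) t 0 := by
  obtain ⟨-, hv0, hsp⟩ := Minkowski.hasDerivAt_of_isFutureTimelikeCurveOn (minkowski_curve hγ) ht
  have hx : 0 < Kerr.radius a (γ t) := Kerr.radius_pos_of_mem_region (γ t).2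
  have hr' : 0 < Kerr.radius a (E4.ofTimeSpace 0 (E4.spatial (γ t : E4))) := by
    rwa [Kerr.radius_ofTimeSpace_spatial]
  have har : |a| ≤ Kerr.radius a (E4.ofTimeSpace 0 (E4.spatial (γ t : E4))) := by
    rw [Kerr.radius_ofTimeSpace_spatial]
    exact (ha.trans (Kerr.lt_radius_of_mem_region (γ t).2)).le
  have h1 := abs_radiusGrad_le hr' har (E4.spatial (deriv (fun σ => (γ σ : E4)) t))
  have hsqrt : Real.sqrt 2 < 3 / 2 := by
    rw [show (3 / 2 : ℝ) = Real.sqrt ((3 / 2) ^ 2) by rw [Real.sqrt_sq]; norm_num]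
    exact Real.sqrt_lt_sqrt (by norm_num) (by norm_num)
  have h2 : Real.sqrt 2 * ‖E4.spatial (deriv (fun σ => (γ σ : E4)) t)‖ ≤
      Real.sqrt 2 * deriv (fun σ => (γ σ : E4)) t 0 :=
    mul_le_mul_of_nonneg_left hsp.le (Real.sqrt_nonneg _)
  nlinarith [Real.sqrt_nonneg 2]

/-- The derivative of the clock `σ ↦ t*(γ σ) + c r(γ σ)`. [folklore] -/
theorem hasDerivAt_clock (c : ℝ) (hγ : (Kerr.smoothMetric M a M).IsFutureTimelikeCurveOn
      ((Kerr.timeOrientation M a M hM).ofLE le_top) γ s) {t : ℝ} (ht : t ∈ s) :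
    HasDerivAt (fun σ => (γ σ : E4) 0 + c * Kerr.radius a (γ σ))
      (deriv (fun σ => (γ σ : E4)) t 0 + c *
        Kerr.radiusGrad a (E4.spatial (γ t : E4)) (E4.spatial (deriv (fun σ => (γ σ : E4)) t))) t :=
  (Minkowski.hasDerivAt_time (minkowski_curve hγ) ht).add ((hasDerivAt_radius_comp hγ ht).const_mul c)

/-- **The clocks**: for `|c| ≤ 2/3` the function `t* + c r` is strictly increasing along future
timelike curves of the chart `{r > M}`, `|a| < M` (derivative `v⁰ + c ṙ ≥ v⁰ − |c| |ṙ| > 0`). [folklore] -/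
theorem strictMonoOn_clock {c : ℝ} (hc : |c| ≤ 2 / 3) (ha : |a| < M) (hs : s.OrdConnected)
    (hγ : (Kerr.smoothMetric M a M).IsFutureTimelikeCurveOn
      ((Kerr.timeOrientation M a M hM).ofLE le_top) γ s) :
    StrictMonoOn (fun σ => (γ σ : E4) 0 + c * Kerr.radius a (γ σ)) s := by
  refine strictMonoOn_of_deriv_pos hs.convex
    (fun t ht => (hasDerivAt_clock c hγ ht).continuousAt.continuousWithinAt) fun t ht => ?_
  have ht' := interior_subset ht
  rw [(hasDerivAt_clock c hγ ht').deriv]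
  have h1 := abs_deriv_radius_lt ha hγ ht'
  obtain ⟨-, hv0, -⟩ := Minkowski.hasDerivAt_of_isFutureTimelikeCurveOn (minkowski_curve hγ) ht'
  set ρ := Kerr.radiusGrad a (E4.spatial (γ t : E4)) (E4.spatial (deriv (fun σ => (γ σ : E4)) t))
  have h2 : |c * ρ| ≤ 2 / 3 * |ρ| := by rw [abs_mul]; exact mul_le_mul_of_nonneg_right hc (abs_nonneg _)
  have h3 : -(c * ρ) ≤ |c * ρ| := neg_le_abs _
  nlinarith [abs_nonneg ρ]

/-- `t*` is strictly increasing along future timelike curves of the chart (the clock `c = 0`,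
equivalently `Minkowski.strictMonoOn_time`). [folklore] -/
theorem strictMonoOn_time' (hs : s.OrdConnected) (hγ : (Kerr.smoothMetric M a M).IsFutureTimelikeCurveOn
      ((Kerr.timeOrientation M a M hM).ofLE le_top) γ s) :
    StrictMonoOn (fun σ => (γ σ : E4) 0) s :=
  Minkowski.strictMonoOn_time hs (minkowski_curve hγ)

end Clocks

/-! ### The Cauchy property of the open slab in the lens, chart form -/

section Cauchy

/-- The inner horizon radius `r₋ = M − √(M² − a²)` is `< M` for `|a| < M`. [folklore] -/
theorem rMinus_lt_self {M a : ℝ} (ha : |a| < M) : Kerr.rMinus M a < M := by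
  have h : 0 < M ^ 2 - a ^ 2 := by
    have := sq_lt_sq' (by linarith [abs_nonneg a, neg_abs_le a]) (lt_of_le_of_lt (le_abs_self a) ha)
    nlinarith [abs_nonneg a, sq_abs a]
  have := Real.sqrt_pos.2 h
  unfold Kerr.rMinus; linarith

/-- The outer horizon radius `r₊ = M + √(M² − a²)` is `> M` for `|a| < M`. [folklore] -/
theorem self_lt_rPlus {M a : ℝ} (ha : |a| < M) : M < Kerr.rPlus M a := by
  have h : 0 < M ^ 2 - a ^ 2 := by
    have := sq_lt_sq' (by linarith [abs_nonneg a, neg_abs_le a]) (lt_of_le_of_lt (le_abs_self a) ha)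
    nlinarith [abs_nonneg a, sq_abs a]
  have := Real.sqrt_pos.2 h
  unfold Kerr.rPlus; linarith

variable [Kerr.Facts]

/-- **The open slab `{t* = 0}` is met exactly once by every future timelike curve of the chart
lying in the lens and without future/past endpoint in the lens** (chart form of (C)).
[cite: ONeill1983, Ch. 14, Def. 14.28] -/
theorem slab_cauchy_chart {M a : ℝ} (hM0 : 0 < M) (ha : |a| < M)
    (γ : ℝ → Kerr.region a M) (s : Set ℝ) (hs : s.OrdConnected) (hne : s.Nonempty)
    (hγ : (Kerr.smoothMetric M a M).IsFutureTimelikeCurveOn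
      ((Kerr.timeOrientation M a M hM0.le).ofLE le_top) γ s)
    (hL : ∀ t ∈ s, γ t ∈ lensK M a)
    (hend : ∀ q : Kerr.region a M, q ∈ lensK M a →
      ¬ HasFutureEndpoint γ s q ∧ ¬ HasPastEndpoint γ s q) :
    ∃! t, t ∈ s ∧ (γ t : E4) 0 = 0 := by
  haveI : Nonempty s := hne.to_subtype
  have hβ := minkowski_curve hγ
  have hmono := strictMonoOn_time' hs hγ
  have hrM : ∀ σ, M < Kerr.radius a (γ σ) := fun σ => Kerr.lt_radius_of_mem_region (γ σ).2
  have hmem : ∀ q : E4, M < Kerr.radius a q → q ∈ Kerr.region a M := fun q hq => by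
    rw [Kerr.mem_region, max_eq_left hM0.le]; exact hq
  -- uniqueness by monotonicity of `t*`; existence is what remains
  suffices hex : ∃ t ∈ s, (γ t : E4) 0 = 0 by
    obtain ⟨t, ht, ht0⟩ := hex
    refine ⟨t, ⟨ht, ht0⟩, ?_⟩
    rintro t' ⟨ht', ht'0⟩
    exact hmono.injOn ht' ht (ht'0.trans ht0.symm)
  by_contra hno
  push Not at hno
  obtain ⟨t₀, ht₀⟩ := hne
  have hcont : ContinuousOn (fun σ => (γ σ : E4) 0) s := Minkowski.continuousOn_time hβ
  have hcr : Continuous fun q : E4 => Kerr.radius a q := Kerr.continuous_radius a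
  have hc0 : Continuous fun q : E4 => q 0 := PiLp.continuous_apply 2 _ 0
  -- the clocks along the curve
  have hw₁ := strictMonoOn_clock (c := 2 / 3) (by rw [abs_of_pos (by norm_num)]) ha hs hγ
  have hw₂ := strictMonoOn_clock (c := -(2 / 3)) (by rw [abs_neg, abs_of_pos (by norm_num)]) ha hs hγ
  have hf₃ := strictMonoOn_clock (c := 1 / 2) (by rw [abs_of_pos (by norm_num)]; norm_num) ha hs hγ
  obtain ⟨hL1, hL2, hL3⟩ := hL t₀ ht₀
  rcases lt_or_gt_of_ne (hno t₀ ht₀) with hneg | hpos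
  · /- below the slab: futureward escape.  `t* < 0` on `s`, bounded above, so the coordinate curve has
      a future endpoint `q` in `E4`; the clocks `t* − (2/3) r`, `t* + r/2` (increasing) and `t* ≤ 0`
      put `q` in the lens: contradiction. -/
    have hall : ∀ t ∈ s, (γ t : E4) 0 < 0 := by
      intro t ht
      by_contra hge
      push Not at hge
      obtain ⟨c, hc, hc0'⟩ := hs.isPreconnected.intermediate_value ht₀ ht hcont ⟨hneg.le, hge⟩
      exact hno c hc hc0'
    have hbdd : BddAbove ((fun σ => (γ σ : E4) 0) '' s) :=
      ⟨0, by rintro _ ⟨σ, hσ, rfl⟩; exact (hall σ hσ).le⟩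
    obtain ⟨q, hq⟩ : ∃ q : E4, HasFutureEndpoint (fun σ => (γ σ : E4)) s q := by
      by_contra hcon
      push Not at hcon
      exact Minkowski.not_bddAbove_time hs hβ ⟨⟨t₀, ht₀⟩, hcon⟩ hbdd
    have hqr : Tendsto (fun σ : s => Kerr.radius a (γ σ)) atTop (𝓝 (Kerr.radius a q)) :=
      (hcr.tendsto q).comp hq
    have hq0 : Tendsto (fun σ : s => (γ σ : E4) 0) atTop (𝓝 (q 0)) := (hc0.tendsto q).comp hq
    have hq0le : q 0 ≤ 0 := le_of_tendsto' hq0 fun σ => (hall σ σ.2).le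
    have h2 : (γ t₀ : E4) 0 + -(2 / 3) * Kerr.radius a (γ t₀) ≤ q 0 + -(2 / 3) * Kerr.radius a q := by
      refine ge_of_tendsto (hq0.add (hqr.const_mul (-(2 / 3)))) ?_
      filter_upwards [eventually_ge_atTop (⟨t₀, ht₀⟩ : s)] with σ hσ
      exact hw₂.monotoneOn ht₀ σ.2 hσ
    have h3 : (γ t₀ : E4) 0 + 1 / 2 * Kerr.radius a (γ t₀) ≤ q 0 + 1 / 2 * Kerr.radius a q := by
      refine ge_of_tendsto (hq0.add (hqr.const_mul (1 / 2))) ?_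
      filter_upwards [eventually_ge_atTop (⟨t₀, ht₀⟩ : s)] with σ hσ
      exact hf₃.monotoneOn ht₀ σ.2 hσ
    have hrq : M < Kerr.radius a q := by linarith
    have hqL : (⟨q, hmem q hrq⟩ : Kerr.region a M) ∈ lensK M a := by
      refine ⟨?_, ?_, ?_⟩ <;> simp only <;> linarith
    exact (hend ⟨q, hmem q hrq⟩ hqL).1 ((hasFutureEndpoint_subtypeVal_comp_iff (p := ⟨q, hmem q hrq⟩)).1 hq)
  · /- above the slab: pastward escape.  `t* > 0` on `s`, bounded below, so the coordinate curve has a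
      past endpoint `q`; the clock `t* + (2/3) r` bounds the first two lens functions at `q` from below,
      and `r(q) > M` (the hole clock excludes `r(q) = M`), so `q` is in the lens: contradiction. -/
    have hall : ∀ t ∈ s, 0 < (γ t : E4) 0 := by
      intro t ht
      by_contra hle
      push Not at hle
      obtain ⟨c, hc, hc0'⟩ := hs.isPreconnected.intermediate_value ht ht₀ hcont ⟨hle, hpos.le⟩
      exact hno c hc hc0'
    have hbdd : BddBelow ((fun σ => (γ σ : E4) 0) '' s) :=
      ⟨0, by rintro _ ⟨σ, hσ, rfl⟩; exact (hall σ hσ).le⟩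
    obtain ⟨q, hq⟩ : ∃ q : E4, HasPastEndpoint (fun σ => (γ σ : E4)) s q := by
      by_contra hcon
      push Not at hcon
      exact Minkowski.not_bddBelow_time hs hβ ⟨⟨t₀, ht₀⟩, hcon⟩ hbdd
    have hqr : Tendsto (fun σ : s => Kerr.radius a (γ σ)) atBot (𝓝 (Kerr.radius a q)) :=
      (hcr.tendsto q).comp hq
    have hq0 : Tendsto (fun σ : s => (γ σ : E4) 0) atBot (𝓝 (q 0)) := (hc0.tendsto q).comp hq
    have hq0ge : 0 ≤ q 0 := ge_of_tendsto' hq0 fun σ => (hall σ σ.2).le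
    have h1 : q 0 + 2 / 3 * Kerr.radius a q ≤ (γ t₀ : E4) 0 + 2 / 3 * Kerr.radius a (γ t₀) := by
      refine le_of_tendsto (hq0.add (hqr.const_mul (2 / 3))) ?_
      filter_upwards [eventually_le_atBot (⟨t₀, ht₀⟩ : s)] with σ hσ
      exact hw₁.monotoneOn σ.2 ht₀ hσ
    have hrqM : M ≤ Kerr.radius a q := ge_of_tendsto' hqr fun σ => (hrM σ).le
    rcases hrqM.lt_or_eq with hrq | hrq
    · have hqL : (⟨q, hmem q hrq⟩ : Kerr.region a M) ∈ lensK M a := by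
        refine ⟨?_, ?_, ?_⟩ <;> simp only <;> linarith
      exact (hend ⟨q, hmem q hrq⟩ hqL).2 ((hasPastEndpoint_subtypeVal_comp_iff (p := ⟨q, hmem q hrq⟩)).1 hq)
    · have hev : ∀ᶠ σ : s in atBot, Kerr.radius a (γ σ) < Kerr.rPlus M a :=
        hqr.eventually (Iio_mem_nhds (by rw [← hrq]; exact self_lt_rPlus ha))
      obtain ⟨σ₁, hσ₁⟩ := hev.exists_forall_of_atBot
      have hanti := strictAntiOn_radius ha (rMinus_lt_self ha) (hs.inter ordConnected_Iic)
        inter_subset_left hγ (s' := s ∩ Iic (σ₁ : ℝ)) (fun σ hσ => hσ₁ ⟨σ, hσ.1⟩ hσ.2)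
      have hge : ∀ᶠ σ : s in atBot, Kerr.radius a (γ σ₁) ≤ Kerr.radius a (γ σ) := by
        filter_upwards [eventually_le_atBot σ₁] with σ hσ
        exact hanti.antitoneOn ⟨σ.2, hσ⟩ ⟨σ₁.2, self_mem_Iic⟩ hσ
      have hle := ge_of_tendsto hqr hge
      linarith [hrM σ₁]

/-- **(C3) The open slab is a Cauchy hypersurface of the lens** (packaged form: every endless
timelike curve of the open sub-spacetime `V_K` meets `val⁻¹' slab°` exactly once).
[cite: ONeill1983, Ch. 14, Def. 14.28] -/
theorem isCauchyHypersurface_slabKo {M a : ℝ} (hM0 : 0 < M) (ha : |a| < M) :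
    ((Kerr.spacetime M a M hM0.le).metric.restrict PseudoRiemannianMetric.contMDiff_restrict_holds
        ⟨lensK M a, isOpen_lensK M a⟩).IsCauchyHypersurface
      ((Kerr.spacetime M a M hM0.le).timeOrientation.restrict
        PseudoRiemannianMetric.contMDiff_restrict_holds
        (Kerr.spacetime M a M hM0.le).timeOrientation.contMDiff_restrict_holds
        ⟨lensK M a, isOpen_lensK M a⟩)
      (Subtype.val ⁻¹' slabKo M a) := by
  intro γ s hγ
  obtain ⟨hs, htl, hfe, hpe⟩ := hγ
  have htl' := (LorentzianMetric.isFutureTimelikeCurveOn_restrict_iff _ _ _ _ _).1 htl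
  have hL : ∀ t ∈ s, (Subtype.val ∘ γ) t ∈ lensK M a := fun t _ => (γ t).2
  have hend : ∀ q : Kerr.region a M, q ∈ lensK M a →
      ¬ HasFutureEndpoint (Subtype.val ∘ γ) s q ∧ ¬ HasPastEndpoint (Subtype.val ∘ γ) s q :=
    fun q hq => ⟨fun h => hfe.2 ⟨q, hq⟩ (hasFutureEndpoint_subtypeVal_comp_iff.1 h),
      fun h => hpe.2 ⟨q, hq⟩ (hasPastEndpoint_subtypeVal_comp_iff.1 h)⟩
  obtain ⟨t, ⟨hts, ht⟩, huniq⟩ := slab_cauchy_chart hM0 ha (Subtype.val ∘ γ) s hs hfe.1 htl' hL hend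
  refine ⟨t, ⟨hts, ?_⟩, fun t' ht' => huniq t' ⟨ht'.1, ht'.2.1⟩⟩
  refine ⟨ht, ?_⟩
  have ht' : ((γ t).1.1 : E4) 0 = 0 := ht
  have h1' : 0 < 6 * M - 2 * Kerr.radius a (γ t).1.1 - 3 * ((γ t).1.1 : E4) 0 := (γ t).2.1
  show Kerr.radius a (γ t).1.1 < 3 * M
  linarith

end Cauchy

/-! ### The future part of the lens lies in the chronological future of the slab -/

section Future

variable [Kerr.Facts]

/-- **(C4)**: `V_K ∩ {t* > 0} ⊆ I⁺_{V_K}(slab°)` — the endless timelike curve through a point of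
the lens (`exists_isEndlessTimelikeCurve_through`) meets `slab°` exactly once, and by the clock
`t*` this happens strictly before the point when `t* > 0` there. [cite: ONeill1983, Ch. 14, p. 415] -/
theorem diamondK_subset_chronologicalFuture {M a : ℝ} (hM0 : 0 < M) (ha : |a| < M) :
    (Subtype.val ⁻¹' diamondK M a : Set (⟨lensK M a, isOpen_lensK M a⟩ : Opens (Kerr.region a M))) ⊆
      ((Kerr.spacetime M a M hM0.le).metric.restrict PseudoRiemannianMetric.contMDiff_restrict_holds
        ⟨lensK M a, isOpen_lensK M a⟩).chronologicalFuture
      ((Kerr.spacetime M a M hM0.le).timeOrientation.restrict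
        PseudoRiemannianMetric.contMDiff_restrict_holds
        (Kerr.spacetime M a M hM0.le).timeOrientation.contMDiff_restrict_holds
        ⟨lensK M a, isOpen_lensK M a⟩)
      (Subtype.val ⁻¹' slabKo M a) := by
  intro z hz
  have hn2 : (2 : ℕ∞ω) ≤ ((⊤ : ℕ∞) : ℕ∞ω) := WithTop.coe_le_coe.mpr le_top
  obtain ⟨Δ, D, hΔ, h0D, hΔ0⟩ := LorentzianMetric.exists_isEndlessTimelikeCurve_through
    (g := (Kerr.spacetime M a M hM0.le).metric.restrict PseudoRiemannianMetric.contMDiff_restrict_holds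
        ⟨lensK M a, isOpen_lensK M a⟩)
    (τ := (Kerr.spacetime M a M hM0.le).timeOrientation.restrict
        PseudoRiemannianMetric.contMDiff_restrict_holds
        (Kerr.spacetime M a M hM0.le).timeOrientation.contMDiff_restrict_holds
        ⟨lensK M a, isOpen_lensK M a⟩) hn2 z
  obtain ⟨t₁, ⟨ht₁D, ht₁S⟩, -⟩ := isCauchyHypersurface_slabKo hM0 ha Δ D hΔ
  set γ' : ℝ → Kerr.region a M := Subtype.val ∘ Δ with hγ'
  have htl' : (Kerr.smoothMetric M a M).IsFutureTimelikeCurveOn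
      ((Kerr.timeOrientation M a M hM0.le).ofLE le_top) γ' D :=
    (LorentzianMetric.isFutureTimelikeCurveOn_restrict_iff _ _ _ _ _).1 hΔ.2.1
  have hmono := strictMonoOn_time' hΔ.1 htl'
  have hz0 : 0 < ((z : Kerr.region a M) : E4) 0 := hz.1
  rcases lt_trichotomy t₁ 0 with ht | rfl | ht
  · exact ⟨Δ t₁, ht₁S, Δ, t₁, 0, ht, hΔ.2.1.mono (hΔ.1.out ht₁D h0D), rfl, hΔ0⟩
  · exfalso
    rw [hΔ0] at ht₁S
    have : ((z : Kerr.region a M) : E4) 0 = 0 := ht₁S.1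
    linarith
  · exfalso
    have h := hmono h0D ht₁D ht
    have h1 : (γ' t₁ : E4) 0 = 0 := ht₁S.1
    have h0 : (γ' 0 : E4) 0 = ((z : Kerr.region a M) : E4) 0 := by
      have : γ' 0 = (z : Kerr.region a M) := by rw [hγ', Function.comp_apply, hΔ0]
      rw [this]
    simp only at h
    linarith

end Future

/-! ### Connectedness of the open slab and of the lens -/

end F1Route

/-- **Registered bookkeeping sub-goal `stub_slabLensCauchyChart` of the line** (brick of the landing
of F1' `stub_slabCauchyRigidity'`): the Cauchy and chronology clauses of route statement (C)
`F1Route.KerrSlabLensCauchy` — in the Kerr star chart `{r > M}` (`0 < M`, `|a| < M`) the open slab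
`slab°` is a Cauchy hypersurface of the open sub-spacetime `V_K = lensK M a`, and the future part
`diamondK M a` of the lens lies in `I⁺_{V_K}(slab°)`. [cite: ONeill1983, Ch. 14, Def. 14.28] -/
theorem stub_slabLensCauchyChart : ∀ [Kerr.Facts] (M a : ℝ) (hM : 0 < M), |a| < M →
    ((Kerr.spacetime M a M hM.le).metric.restrict PseudoRiemannianMetric.contMDiff_restrict_holds
        ⟨F1Route.lensK M a, F1Route.isOpen_lensK M a⟩).IsCauchyHypersurface
      ((Kerr.spacetime M a M hM.le).timeOrientation.restrict
        PseudoRiemannianMetric.contMDiff_restrict_holds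
        (Kerr.spacetime M a M hM.le).timeOrientation.contMDiff_restrict_holds
        ⟨F1Route.lensK M a, F1Route.isOpen_lensK M a⟩)
      (Subtype.val ⁻¹' F1Route.slabKo M a) ∧
    (Subtype.val ⁻¹' F1Route.diamondK M a :
        Set (⟨F1Route.lensK M a, F1Route.isOpen_lensK M a⟩ : Opens (Kerr.region a M))) ⊆
      ((Kerr.spacetime M a M hM.le).metric.restrict PseudoRiemannianMetric.contMDiff_restrict_holds
        ⟨F1Route.lensK M a, F1Route.isOpen_lensK M a⟩).chronologicalFuture
      ((Kerr.spacetime M a M hM.le).timeOrientation.restrict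
        PseudoRiemannianMetric.contMDiff_restrict_holds
        (Kerr.spacetime M a M hM.le).timeOrientation.contMDiff_restrict_holds
        ⟨F1Route.lensK M a, F1Route.isOpen_lensK M a⟩)
      (Subtype.val ⁻¹' F1Route.slabKo M a) :=
  fun _ _ hM ha =>
    ⟨F1Route.isCauchyHypersurface_slabKo hM ha, F1Route.diamondK_subset_chronologicalFuture hM ha⟩

end Summit.FinalStateConjecture.FinalStateConjecture.Theorems.BondiBartnikRigidity.DirectMethod

end
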